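import Literature.AnabelianGeometry.AbsoluteAnabelian.AbsTopIII.AutHolLogFrobeniusCor45iiProofs
import Literature.AnabelianGeometry.AbsoluteAnabelian.AbsTopIII.AutHolLogFrobeniusCor45ivModelProofs
import Literature.AnabelianGeometry.AbsoluteAnabelian.AbsTopIII.AutHolLogFrobeniusNexusRigidityProofs
import Literature.AnabelianGeometry.AbsoluteAnabelian.AbsTopIII.FrobeniusPictureMLFSchemaNegative
import Literature.AnabelianGeometry.AbsoluteAnabelian.ArchimedeanHolPairsRigidityProofs
import Mathlib.CategoryTheory.SingleObj
import Mathlib.CategoryTheory.Groupoid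
import Mathlib.CategoryTheory.Category.ULift
import Mathlib.CategoryTheory.PEmpty
import Mathlib.Data.ZMod.Basic
import HarnessLib

/-!
# [AbsTopIII] Cor. 4.5 (ii), (iv), (v) as SCHEMATA (FACT-LIST F-0307, F-0309, F-0310): kernel verdicts

S. Mochizuki, *Topics in Absolute Anabelian Geometry III*, §4, Corollary 4.5 (ii) p. 108, (iv) p. 109,
(v) p. 109 of the kurims manuscript (`paper:url-5493eb38cbb7`; bib key `MochizukiAbsTopIII2015`).
PROOF-ONLY companion of `AbsTopIII/AutHolLogFrobenius.lean` (abc-iut cell, F fact-proving wave, seat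
abc-iut-f-071, tranche 71: rows **F-0307** `AbsTopIII.Cor_4_5_ii`, **F-0309** `AbsTopIII.Cor_4_5_iv`,
**F-0310** `AbsTopIII.Cor_4_5_v`; class `preparatory`, kernel_closedness `parametrised`).  No notion is
declared, nothing of the statement files is restated; the three typed items
`Cor_4_5_ii Δ τ := Δ.TelecoreStmt τ`, `Cor_4_5_iv Δ τ := Δ.IncompatibleStmt ∧ Δ.TelecoreIncompatibleStmt τ`,
`Cor_4_5_v Δ := Δ.NexusRigidStmt ∧ Δ.ShiftStmt` are PREDICATES on ABSTRACT input data
`Δ : LogFrobeniusData` (six categories, functors, natural transformations) and first-row telecore data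
`τ : Δ.TelecoreData` (cell ruling ν: the geometric instance "the data of Def. 4.1 arising from elliptically
admissible Aut-holomorphic orbispaces" is not constructed in the tree).  Plan rule R1 for parametrised
rows: decide the UNIVERSAL CLOSURE; if false file `not_forall_<decl>` and prove / cite the instance forms.

Kernel verdict, row by row (the heavy lifting is the W6 cone provers' and is CITED BY NAME: w6-d023
`AutHolLogFrobeniusCor45iiProofs`, w6-d024 `AutHolLogFrobeniusCor45ivModelProofs`, w6-d025
`AutHolLogFrobeniusNexusRigidityProofs`; f-080 `FrobeniusPictureMLFSchemaNegative`; w5-d061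
`FrobeniusPictureMLFTelecoreCountermodel`/`…Iff`):

* **F-0307 (ii).**  `not_forall_cor_4_5_ii` — the universal closure `∀ Δ τ, Cor_4_5_ii Δ τ` is FALSE
  (w6-d023's archimedean-direction twisted one-object groupoid of `ℤ/2`, `exists_isAutHolDirection_not_cor_4_5_ii`:
  the printed clause "`η_⋏` the isomorphism ARISING FROM `η_LH`" is used essentially — `Cor_4_5_ii Δ τ ↔`
  coherence of `η_⋎` with `η_LH` under fully faithful `id_⋎`, `cor_4_5_ii_iff_coherent`); instance forms
  PROVED with ZERO binders at every archimedean model (`cor_4_5_ii_arch 𝔄`, `_TM`, Galois, geometric) and at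
  the input-record level (`MonoAnabelianLogFrobeniusData.cor_4_5_ii`).  Verdict `cor_4_5_ii_schema_verdict`.
* **F-0309 (iv).**  `not_forall_cor_4_5_iv` — FALSE universally: the EMPTY archimedean-direction datum
  (`exists_isAutHolDirection_not_cor_4_5_iv`, all six categories `Discrete PEmpty`; with `𝒳₁, 𝒳, 𝒩` empty the
  family of ALL co-verticial pairs with empty homotopies contains the would-be core isomorphisms and the
  `𝔖_log` generators, w6-d024's `not_incompatibleStmt_of_isEmpty`), and the archimedean MODELS over the empty
  interface / the empty admissibility class fail too (`not_cor_4_5_iv_arch_ofConstField_pempty`,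
  `not_cor_4_5_iv_geometric_bot`); instance form PROVED from ONE object (`cor_4_5_iv_arch 𝔄 X₀`, Lemma 4.4
  discharged, no id-rigidity) and EXACTLY characterised: `Cor_4_5_iv (archLogFrobeniusData 𝔄) _ ↔ Nonempty 𝔄.EA`
  (`cor_4_5_iv_arch_iff_nonempty`).  Verdict `cor_4_5_iv_schema_verdict`.
* **F-0310 (v).**  `not_forall_cor_4_5_v` — FALSE universally (`Cor_4_5_v Δ ↔ IsIdRigid 𝒳₁ ∧ IsIdRigid 𝒳 ∧`
  `id_⋎` rigid, w6-d025's `cor_4_5_v_iff`; f-080's one-object groupoid datum `not_forall_nexusRigidStmt`), and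
  in the archimedean direction at the MODEL over any non-id-rigid `EA` — here the one-object category of
  `ℤ/2` (`not_cor_4_5_v_arch_ofConstField_singleObj`, via `not_isIdRigid_singleObj`: a commutative group with
  an element `≠ 1` is a non-id-rigid one-object category, Rmk. 4.2.1's mechanism); instance form PROVED from
  the id-rigidity of `EA` ALONE and EXACTLY characterised: `Cor_4_5_v (archLogFrobeniusData 𝔄) ↔ IsIdRigid 𝔄.EA`
  (`cor_4_5_v_arch_iff`; unconditional at `EA = B(G_{ℚ_p})` by slimness).  Verdict `cor_4_5_v_schema_verdict`.
* `exists_isAutHolDirection_cor_4_5_items` — the three items hold JOINTLY at a non-degenerate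
  archimedean-direction instance already in the tree (`cor_4_5_arch_absoluteGaloisGroup_padic 2`).

So F-0307/F-0309/F-0310 are admissible ONLY in their instance forms («universal-closure REFUTED; instance
form PROVED at the models / conditional over abstract data»); none may be bound as a `∀ Δ`-hypothesis of a
conditional certificate.  HONEST FRAMING: statements about the cell's own typing of a refereed pre-IUT
corollary over abstract data; the printed Cor. 4.5 concerns specific geometric data and is neither refuted
nor proved here; nothing here bears on [IUTchIII] Cor. 3.12 or takes a side; typed ≠ proved.
-/

namespace Literature.AnabelianGeometry.AbsoluteAnabelian

open _root_.CategoryTheory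

universe w v u

/-! ### A one-object toolkit lemma (Rmk. 4.2.1's mechanism in its smallest instance) -/

/-- **A commutative group with an element `g ≠ 1` is, as a one-object category, NOT id-rigid**: `g` is a
central non-identity endomorphism of the unique object, hence (abc-iut's `not_isIdRigid_of_central`) a
non-trivial automorphism of the identity functor.  [cite: MochizukiAbsTopIII2015, Remark 4.2.1 p.106] -/
theorem not_isIdRigid_singleObj {G : Type u} [CommGroup G] (g : G) (hg : g ≠ 1) :
    ¬ IsIdRigid (SingleObj G) :=
  not_isIdRigid_of_central (G := SingleObj G) (SingleObj.star G) g
    (by rwa [Ne, SingleObj.id_as_one])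
    (fun f => by rw [SingleObj.comp_as_mul, SingleObj.comp_as_mul, mul_comm])

/-- **Id-rigidity descends along Mathlib's `AsSmall` resizing** (objects and hom-types `ULift`ed): an
automorphism `α` of `𝟭_C` lifts, by `ULift.up` on components, to an automorphism of `𝟭_{AsSmall C}`, whose
components are identities if `AsSmall C` is id-rigid.  (Companion of abc-iut-w6-d025's
`isIdRigid_of_isIdRigid_uLiftHom`; used to place a small category in the universe of the interface
`AutHolFieldFunctor.ofConstField`.) [cite: MochizukiAbsTopIII2015, Section 0 p.27] -/
theorem isIdRigid_of_isIdRigid_asSmall {C : Type u} [Category.{v} C] (h : IsIdRigid (AsSmall.{w} C)) :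
    IsIdRigid C := by
  refine isRigidFunctor_of_hom_app_eq_id fun α x => ?_
  let β : 𝟭 (AsSmall.{w} C) ≅ 𝟭 (AsSmall.{w} C) :=
    NatIso.ofComponents
      (fun y =>
        { hom := ULift.up (α.hom.app (ULift.down y))
          inv := ULift.up (α.inv.app (ULift.down y))
          hom_inv_id := congrArg ULift.up (α.hom_inv_id_app (ULift.down y))
          inv_hom_id := congrArg ULift.up (α.inv_hom_id_app (ULift.down y)) })
      (fun {y y'} f => congrArg ULift.up (α.hom.naturality f.down))
  have hβ : β.hom.app (AsSmall.up.obj x) = 𝟙 (AsSmall.up.obj x) := h.hom_app_eq_id β (AsSmall.up.obj x)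
  exact congrArg ULift.down hβ

/-- Hence the (resized) one-object category of a commutative group with an element `≠ 1` is not id-rigid.
[cite: MochizukiAbsTopIII2015, Remark 4.2.1 p.106] -/
theorem not_isIdRigid_asSmall_singleObj {G : Type} [CommGroup G] (g : G) (hg : g ≠ 1) :
    ¬ IsIdRigid (AsSmall.{1, 0, 0} (SingleObj G)) :=
  fun h => not_isIdRigid_singleObj g hg (isIdRigid_of_isIdRigid_asSmall h)

namespace AbsTopIII

/-! ### F-0307 — Cor. 4.5 (ii) `Cor_4_5_ii Δ τ` -/

/-- **F-0307, universal closure REFUTED.**  Cor. 4.5 (ii) as typed (`Cor_4_5_ii Δ τ := Δ.TelecoreStmt τ`)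
does NOT hold for all abstract input data and all first-row telecore data: at abc-iut-w6-d023's
archimedean-direction datum with the telecore identification `e` twisted by the central `g ≠ 1` of `ℤ/2`
(`exists_isAutHolDirection_not_cor_4_5_ii`; the coherence forced by w5-d061's `coherent_of_telecoreStmt`
reads `1 = g`) it fails.  R5: the row is consumed at named instances only.
[cite: MochizukiAbsTopIII2015, Corollary 4.5 (ii) p.108] -/
theorem not_forall_cor_4_5_ii :
    ¬ ∀ (Δ : LogFrobeniusData.{0}) (τ : Δ.TelecoreData),
      Literature.AnabelianGeometry.AbsoluteAnabelian.AbsTopIII.Cor_4_5_ii Δ τ := by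
  intro h
  obtain ⟨Δ, τ, -, -, hnot⟩ := exists_isAutHolDirection_not_cor_4_5_ii
  exact hnot (h Δ τ)

/-- **F-0307, kernel verdict**: the universal closure of `Cor_4_5_ii` is refuted AND the item holds with ZERO
binders for the Def. 4.1 data over EVERY Cor. 2.7 (e)-interface datum `𝔄` (`𝒳 = 𝒞^hol_TF`,
`τ = ⟨φ_LH, unitor, η_LH⟩`; abc-iut-w6-d023's `cor_4_5_ii_arch`, over abc-iut-L4-t5's
`cor_4_5_ii_of_coherent`) — a genuine hypothesis on abstract data, a theorem at the models.
[cite: MochizukiAbsTopIII2015, Corollary 4.5 (ii) p.108] -/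
theorem cor_4_5_ii_schema_verdict :
    (¬ ∀ (Δ : LogFrobeniusData.{0}) (τ : Δ.TelecoreData),
        Literature.AnabelianGeometry.AbsoluteAnabelian.AbsTopIII.Cor_4_5_ii Δ τ) ∧
      ∀ 𝔄 : AutHolFieldFunctor.{u},
        Literature.AnabelianGeometry.AbsoluteAnabelian.AbsTopIII.Cor_4_5_ii (archLogFrobeniusData 𝔄)
          (archTelecoreData 𝔄) :=
  ⟨not_forall_cor_4_5_ii, cor_4_5_ii_arch⟩

/-! ### F-0309 — Cor. 4.5 (iv) `Cor_4_5_iv Δ τ` -/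

/-- **F-0309, explicit archimedean-direction counterexample to the universal closure (universe `0`)**: the
EMPTY datum — all six categories `Discrete PEmpty`, all functors identities, `ι_× = inr 𝟙` (Aut-holomorphic
orientation), `id_⋎ = 𝟭`, `τ` the unitors — violates Cor. 4.5 (iv) as typed: with `𝒳₁, 𝒳, 𝒩` empty the
family of ALL co-verticial pairs of paths of `𝒟_{≤3}` with (empty) natural transformations contains the
would-be core isomorphisms `([id_{⋎+1}], [id_⋎]∘[log])` AND the `𝔖_log` generators (abc-iut-w6-d024's
`LogFrobeniusData.not_incompatibleStmt_of_isEmpty`), so the first incompatibility `IncompatibleStmt` fails —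
the printed proof (p. 110) needs an object at which Lemma 4.4 bites.
[cite: MochizukiAbsTopIII2015, Corollary 4.5 (iv) p.109] -/
theorem exists_isAutHolDirection_not_cor_4_5_iv :
    ∃ (Δ : LogFrobeniusData.{0}) (τ : Δ.TelecoreData),
      IsAutHolDirection Δ ∧ Nonempty Δ.toNexus.FullyFaithful ∧
        ¬ Literature.AnabelianGeometry.AbsoluteAnabelian.AbsTopIII.Cor_4_5_iv Δ τ := by
  let P : Type := Discrete PEmpty.{1}
  -- the empty datum, Aut-holomorphic orientation
  let Δ : LogFrobeniusData.{0} :=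
    { X₁ := P, X := P, toNexus := 𝟭 _, N := P, E := P, A := P, log := 𝟭 _, logIsoId := Iso.refl _,
      lamTimes := 𝟭 _, lamPf := 𝟭 _, ιlog := (Functor.rightUnitor (𝟭 P ⋙ 𝟭 P)).hom, ιtimes := Sum.inr (𝟙 _),
      XtoE := 𝟭 _, NtoE := 𝟭 _, lamTimes_NtoE := Functor.comp_id _, lamPf_NtoE := Functor.comp_id _,
      κ := 𝟭 _, AtoE := 𝟭 _, κ_equiv := inferInstance, κ_inv := Functor.rightUnitor _,
      φ := 𝟭 _, φ_equiv := inferInstance, η := Functor.rightUnitor _ ≪≫ Functor.rightUnitor _ }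
  -- the printed-shape telecore datum `⟨φ, unitor, η⟩`
  let τ : Δ.TelecoreData :=
    { φ₁ := 𝟭 _
      e := Functor.rightUnitor _
      η₁ := Functor.rightUnitor _ ≪≫ Functor.rightUnitor _ ≪≫ Functor.rightUnitor _ }
  haveI h₁ : IsEmpty Δ.X₁ := inferInstanceAs (IsEmpty (Discrete PEmpty.{1}))
  haveI hX : IsEmpty Δ.X := inferInstanceAs (IsEmpty (Discrete PEmpty.{1}))
  haveI hN : IsEmpty Δ.N := inferInstanceAs (IsEmpty (Discrete PEmpty.{1}))
  exact ⟨Δ, τ, ⟨𝟙 _, rfl⟩, ⟨Functor.FullyFaithful.id _⟩, fun h => Δ.not_incompatibleStmt_of_isEmpty h.1⟩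

/-- **F-0309, universal closure REFUTED.**  Cor. 4.5 (iv) as typed
(`Cor_4_5_iv Δ τ := Δ.IncompatibleStmt ∧ Δ.TelecoreIncompatibleStmt τ`) does NOT hold for all abstract input
data (`exists_isAutHolDirection_not_cor_4_5_iv`).  R5: the row is consumed at named instances only.
[cite: MochizukiAbsTopIII2015, Corollary 4.5 (iv) p.109] -/
theorem not_forall_cor_4_5_iv :
    ¬ ∀ (Δ : LogFrobeniusData.{0}) (τ : Δ.TelecoreData),
      Literature.AnabelianGeometry.AbsoluteAnabelian.AbsTopIII.Cor_4_5_iv Δ τ := by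
  intro h
  obtain ⟨Δ, τ, -, -, hnot⟩ := exists_isAutHolDirection_not_cor_4_5_iv
  exact hnot (h Δ τ)

/-- **F-0309, negative MODEL instance**: for the Def. 4.1 data over the EMPTY interface datum
(`EA := Discrete PEmpty`, abc-iut-L4-t10's `ofConstField`) Cor. 4.5 (iv) as typed FAILS — the object binder
`X₀ : EA` of `cor_4_5_iv_arch` is necessary (abc-iut-w6-d024's `cor_4_5_iv_arch_iff_nonempty`).
[cite: MochizukiAbsTopIII2015, Corollary 4.5 (iv) p.109] -/
theorem not_cor_4_5_iv_arch_ofConstField_pempty :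
    ¬ Literature.AnabelianGeometry.AbsoluteAnabelian.AbsTopIII.Cor_4_5_iv
        (archLogFrobeniusData (AutHolFieldFunctor.ofConstField (Discrete PEmpty.{2})))
        (archTelecoreData (AutHolFieldFunctor.ofConstField (Discrete PEmpty.{2}))) := by
  intro h
  obtain ⟨X⟩ := (cor_4_5_iv_arch_iff_nonempty _).1 h
  exact (X.as : PEmpty).elim

/-- **F-0309, negative GEOMETRIC-model instance**: for the Def. 4.1 data over abc-iut-L4-t14's geometric
carriers `EA^hol_RS(Q)` (connected Riemann surfaces satisfying `Q`, holomorphic finite étale maps, `𝒜_𝕏 = ℂ`)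
with the EMPTY admissibility class `Q = ⊥`, Cor. 4.5 (iv) as typed FAILS (abc-iut-w6-d024's
`HolRS.cor_4_5_iv_geometric_iff : … ↔ ∃ X, Q X`). [cite: MochizukiAbsTopIII2015, Corollary 4.5 (iv) p.109] -/
theorem not_cor_4_5_iv_geometric_bot :
    ¬ Literature.AnabelianGeometry.AbsoluteAnabelian.AbsTopIII.Cor_4_5_iv
        (archLogFrobeniusData (HolRS.geometricAutHolFieldFunctor ⊥))
        (archTelecoreData (HolRS.geometricAutHolFieldFunctor ⊥)) := by
  intro h
  obtain ⟨X, hX⟩ := (HolRS.cor_4_5_iv_geometric_iff ⊥).1 h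
  exact hX

/-- **F-0309, kernel verdict**: the universal closure of `Cor_4_5_iv` is refuted AND, for the Def. 4.1 data
over EVERY Cor. 2.7 (e)-interface datum `𝔄`, the item holds IFF `EA` has an object (abc-iut-w6-d024's
`cor_4_5_iv_arch_iff_nonempty`: Lemma 4.4 discharged at the model, id-rigidity not used) — a genuine
hypothesis on abstract data, a theorem at every inhabited model.
[cite: MochizukiAbsTopIII2015, Corollary 4.5 (iv) p.109] -/
theorem cor_4_5_iv_schema_verdict :
    (¬ ∀ (Δ : LogFrobeniusData.{0}) (τ : Δ.TelecoreData),
        Literature.AnabelianGeometry.AbsoluteAnabelian.AbsTopIII.Cor_4_5_iv Δ τ) ∧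
      ∀ 𝔄 : AutHolFieldFunctor.{u},
        (Literature.AnabelianGeometry.AbsoluteAnabelian.AbsTopIII.Cor_4_5_iv (archLogFrobeniusData 𝔄)
            (archTelecoreData 𝔄) ↔ Nonempty 𝔄.EA) :=
  ⟨not_forall_cor_4_5_iv, cor_4_5_iv_arch_iff_nonempty⟩

/-! ### F-0310 — Cor. 4.5 (v) `Cor_4_5_v Δ` -/

/-- **F-0310, universal closure REFUTED.**  Cor. 4.5 (v) as typed (`Cor_4_5_v Δ := Δ.NexusRigidStmt ∧ Δ.ShiftStmt`)
does NOT hold for all abstract input data: total `□`-rigidity forces the id-rigidity of `𝒳`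
(abc-iut-w6-d025's `cor_4_5_v_iff`), which fails at abc-iut-f-080's one-object groupoid datum of `ℤ/2`
(`LogFrobeniusData.not_forall_nexusRigidStmt`).  R5: the row is consumed at named instances only.
[cite: MochizukiAbsTopIII2015, Corollary 4.5 (v) p.109] -/
theorem not_forall_cor_4_5_v :
    ¬ ∀ Δ : LogFrobeniusData.{0}, Literature.AnabelianGeometry.AbsoluteAnabelian.AbsTopIII.Cor_4_5_v Δ :=
  fun h => LogFrobeniusData.not_forall_nexusRigidStmt fun Δ => (h Δ).1

/-- **F-0310, negative MODEL instance in the Aut-holomorphic direction**: for the Def. 4.1 data over the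
constant-field interface datum on the (resized) one-object category of `ℤ/2` — an `EA` that is NOT id-rigid —
Cor. 4.5 (v) as typed FAILS (abc-iut-w6-d025's `not_cor_4_5_v_arch_ofConstField`): the id-rigidity input
`hE : IsIdRigid EA` of `cor_4_5_arch` / `cor_4_5_v_arch` (Prop. 4.2 (i)) is necessary.
[cite: MochizukiAbsTopIII2015, Corollary 4.5 (v) p.109] -/
theorem not_cor_4_5_v_arch_ofConstField_singleObj :
    ¬ Literature.AnabelianGeometry.AbsoluteAnabelian.AbsTopIII.Cor_4_5_v
        (archLogFrobeniusData (AutHolFieldFunctor.ofConstField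
          (AsSmall.{1, 0, 0} (SingleObj (Multiplicative (ZMod 2)))))) :=
  not_cor_4_5_v_arch_ofConstField
    (not_isIdRigid_asSmall_singleObj (Multiplicative.ofAdd (1 : ZMod 2)) (by decide))

/-- **F-0310, kernel verdict**: the universal closure of `Cor_4_5_v` is refuted AND, for the Def. 4.1 data
over EVERY Cor. 2.7 (e)-interface datum `𝔄`, the item holds IFF `EA` is id-rigid (abc-iut-w6-d025's
`cor_4_5_v_arch_iff`; Prop. 4.2 (i), from Lemma 4.3's slimness: `cor_4_5_v_arch_of_isSlim`,
`cor_4_5_v_arch_ofGaloisCategory`) — a genuine hypothesis on abstract data, a theorem at every id-rigid model.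
[cite: MochizukiAbsTopIII2015, Corollary 4.5 (v) p.109] -/
theorem cor_4_5_v_schema_verdict :
    (¬ ∀ Δ : LogFrobeniusData.{0}, Literature.AnabelianGeometry.AbsoluteAnabelian.AbsTopIII.Cor_4_5_v Δ) ∧
      ∀ 𝔄 : AutHolFieldFunctor.{u},
        (Literature.AnabelianGeometry.AbsoluteAnabelian.AbsTopIII.Cor_4_5_v (archLogFrobeniusData 𝔄) ↔
          IsIdRigid 𝔄.EA) :=
  ⟨not_forall_cor_4_5_v, cor_4_5_v_arch_iff⟩

/-! ### The three items jointly, at a non-degenerate archimedean-direction instance -/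

/-- **F-0307/F-0309/F-0310 are JOINTLY satisfiable in the Aut-holomorphic direction at a non-toy instance
already PROVED in the tree**: the Def. 4.1 data over the Galois category of `Π = G_{ℚ_2}` (abc-iut-L4-t10's
`cor_4_5_arch_absoluteGaloisGroup_padic`: an object = the one-point `Π`-set, id-rigidity from the slimness
of `G_{ℚ_p}`, Lemma 4.3's route).  [cite: MochizukiAbsTopIII2015, Corollary 4.5 pp.107–109] -/
theorem exists_isAutHolDirection_cor_4_5_items :
    ∃ (Δ : LogFrobeniusData.{1}) (τ : Δ.TelecoreData), IsAutHolDirection Δ ∧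
      Literature.AnabelianGeometry.AbsoluteAnabelian.AbsTopIII.Cor_4_5_ii Δ τ ∧
      Literature.AnabelianGeometry.AbsoluteAnabelian.AbsTopIII.Cor_4_5_iv Δ τ ∧
      Literature.AnabelianGeometry.AbsoluteAnabelian.AbsTopIII.Cor_4_5_v Δ := by
  haveI : Fact (Nat.Prime 2) := ⟨Nat.prime_two⟩
  obtain ⟨-, h2, -, h4, h5⟩ := (cor_4_5_iff _ _).mp (cor_4_5_arch_absoluteGaloisGroup_padic 2)
  exact ⟨_, _, arch_isAutHolDirection _, h2, h4, h5⟩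

end AbsTopIII

end Literature.AnabelianGeometry.AbsoluteAnabelian
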